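import Mathlib
import HarnessLib
import Summits.Ventures.LatticeQCDFlow.Scaling.AutoregressiveGaugeHeatBathTorusPerimeter
import Summits.Ventures.LatticeQCDFlow.Scoring.FlowSamplerAutocorrelation
import Summits.Ventures.LatticeQCDFlow.Scoring.NonabelianAreaLaw2DWilsonLoop

/-!
# LatticeQCDFlow / Scaling — a PERIMETER-LAW CEILING on the integrated autocorrelation time of every
# event for the exact sampler of the periodic two-dimensional target built on the free-boundary
# heat-bath autoregressive proposal

HONEST FRAMING: exact (Metropolis-corrected) sampling algorithms for lattice gauge theory;
figures of merit are autocorrelation/cost numbers at stated couplings and volumes; no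
continuum-physics claim.

Venture `LatticeQCDFlow` (cell pub-lqcd), topic `Scaling`, FANOUT row 30 (lean-1, GEN-23) — OUR WORK on
THEORY-2.md §4 row C5, the Markov-chain consequence of `Scaling/AutoregressiveGaugeHeatBathTorusPerimeter`.
By `Scaling/AutoregressiveGaugeHeatBathExact2D` the law of the one-plaquette heat-bath autoregressive
sampler of the free-boundary `R × T₀` block `B` of `(ℤ/L)²` is `q = (F_B/Z_B)·Haar^{⊗E}`,
`F_B(U) = ∏_{p∈B} w(U_p)`, `Z_B = c^{RT₀}`.  The independence Metropolis–Hastings chain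
(`Exactness/IMHKernel.indepMH`) with proposal `q` and importance weight `F_R(U) = ∏_{p∉B} w(U_p)` is
EXACT for the periodic target `π ∝ F_R·q ∝ (∏_{all p} w(U_p))·Haar^{⊗E}` (`indepMH_invariant`); with
`0 < m ≤ w ≤ M` the weight is squeezed, `m^k ≤ F_R ≤ M^k`, `k = #(plaquettes outside B)`, so the chain
is DOEBLIN with constant `ε = (m/M)^k` (`indepMH_apply_ge`) and `Exactness/DoeblinTauInt.tauInt_setACF_le`
bounds the scorers' integrated autocorrelation time of EVERY event `A` (`0 < π(A) < 1`):
`τ_int(1_A) ≤ 1/2 + (1 − (m/M)^k)/((m/M)^k (1 − π(A)))`.  With `R = T₀ = L − 1`, `k = 2L − 1`: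
A PERIMETER LAW — for the Wilson weight (`m/M = e^{−2β}`) `τ_int ≤ 1/2 + e^{2β(2L−1)}/(1 − π(A))`,
against the AREA-law floors `τ_int ≥ exp(c·L²) − ½` proved for endpoint-blind autoregressive
proposals (`Scaling/AutoregressiveGaugeSlowingDown`, `…KLExtensive…`).  The theorem is stated for an
ARBITRARY set `B` of plaquettes: for `B` = all plaquettes but one, `k = 1` and `τ_int ≤ M/m − 1/2`
UNIFORMLY IN THE VOLUME — the proposal law `q_B` is then that of a ranked (peelable,
`Scaling/PlaquetteTopLinkOrders` §4) but non-rectangular complex, whose heat-bath exactness is NOT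
formalised in the tree (only rectangles, `…HeatBathExact2D`); recorded as the next target.

## What is proved (all [ours])

* `continuous_prodPlaquetteWeight`, `pow_le_prodPlaquetteWeight_le_pow`, `isProbabilityMeasure_haarPi_withDensity_div_integral`
  — the block / complement / full weights are continuous, squeezed between powers of `m` and `M`, and
  their normalisations are probability densities against `Haar^{⊗E}`.
* **`hbProposal_autocorrelation`** — for ANY set `B` of plaquettes (`k = #Bᶜ`): with
  `π = (F/Z)·Haar^{⊗E}`, `q = (F_B/Z_B)·Haar^{⊗E}`, `ρ = Z/(Z_B F_R)`, the kernel `indepMH q (1/ρ)`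
  satisfies `|C_f(t)| ≤ (1 − (m/M)^k)^t ∫ f² dπ` and `τ_int(f) ≤ (M/m)^k − 1/2` for every bounded
  measurable `π`-centred `f` (via row 8's `indepMH_autocorrelation_of_density_ratio`).
* **`hbProposal_autocorrelation_perimeter`** — `B` the `(L−1) × (L−1)` block: `k = 2L − 1`.

No `def`, no `sorry`, nothing cited as a fact.
-/

namespace Summit.Ventures.LatticeQCDFlow.Theory2.Autoregressive

open MeasureTheory ProbabilityTheory Function Finset
open Literature.MathematicalPhysics.QuantumFieldTheory Literature.MathematicalPhysics.QuantumLattice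
open Summit.Ventures.LatticeQCDFlow.Exactness Summit.Ventures.LatticeQCDFlow.Scoring
open Summit.Ventures.LatticeQCDFlow.Theory2.Lattice Summit.Ventures.LatticeQCDFlow.Theory2.Lattice.TwoDim
open scoped ENNReal

variable {L : ℕ} [NeZero L] {G : Type*} [Group G] [TopologicalSpace G] [IsTopologicalGroup G]
  [CompactSpace G] [SecondCountableTopology G] [MeasurableSpace G] [BorelSpace G]

omit [NeZero L] [CompactSpace G] [SecondCountableTopology G] [MeasurableSpace G] [BorelSpace G] in
/-- A product of plaquette weights over any set of base sites is a continuous function of the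
configuration. [folklore] -/
theorem continuous_prodPlaquetteWeight {w : G → ℝ} (hw : Continuous w) (S : Finset (Site 2 L)) :
    Continuous fun U : GaugeConfig 2 L G => ∏ p ∈ S, w (plaquetteHolonomy U p 0 1) :=
  continuous_finsetProd S fun p _ => hw.comp (continuous_config_plaquetteHolonomy p 0 1)

omit [NeZero L] [TopologicalSpace G] [IsTopologicalGroup G] [CompactSpace G] [SecondCountableTopology G]
  [MeasurableSpace G] [BorelSpace G] in
/-- Squeezing: `m^{#S} ≤ ∏_{p∈S} w(U_p) ≤ M^{#S}` when `0 < m ≤ w ≤ M`. [folklore] -/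
theorem pow_le_prodPlaquetteWeight_le_pow {w : G → ℝ} {m M : ℝ} (hm0 : 0 < m) (hm : ∀ g, m ≤ w g)
    (hM : ∀ g, w g ≤ M) (S : Finset (Site 2 L)) (U : GaugeConfig 2 L G) :
    m ^ S.card ≤ ∏ p ∈ S, w (plaquetteHolonomy U p 0 1) ∧
      ∏ p ∈ S, w (plaquetteHolonomy U p 0 1) ≤ M ^ S.card := by
  constructor
  · rw [← Finset.prod_const]
    exact Finset.prod_le_prod (fun p _ => hm0.le) fun p _ => hm _
  · rw [← Finset.prod_const]
    exact Finset.prod_le_prod (fun p _ => (hm0.trans_le (hm _)).le) fun p _ => hM _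

/-- A continuous positive bounded weight, normalised by its integral, is a probability density against
the product Haar measure. [folklore] -/
theorem isProbabilityMeasure_haarPi_withDensity_div_integral {F : GaugeConfig 2 L G → ℝ} (hFc : Continuous F)
    (hF0 : ∀ U, 0 < F U) {c K : ℝ} (hc0 : 0 < c) (hc : ∀ U, c ≤ F U) (hK : ∀ U, F U ≤ K) :
    IsProbabilityMeasure ((Measure.pi fun _ : Edge 2 L => haarProbability G).withDensity fun U =>
      ENNReal.ofReal (F U / ∫ V, F V ∂(Measure.pi fun _ : Edge 2 L => haarProbability G))) := by
  set Haar : Measure (GaugeConfig 2 L G) := Measure.pi fun _ : Edge 2 L => haarProbability G with hHaar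
  have hi : Integrable F Haar := by
    refine Integrable.mono' (integrable_const K) hFc.aestronglyMeasurable (ae_of_all _ fun U => ?_)
    rw [Real.norm_eq_abs, abs_of_pos (hF0 U)]; exact hK U
  have hZ : 0 < ∫ V, F V ∂Haar := by
    have h := integral_mono (integrable_const c) hi hc
    rw [integral_const, smul_eq_mul, probReal_univ, one_mul] at h
    exact hc0.trans_le h
  constructor
  rw [withDensity_apply _ MeasurableSet.univ, Measure.restrict_univ,
    ← ofReal_integral_eq_lintegral_ofReal (hi.div_const _)
      (ae_of_all _ fun U => div_nonneg (hF0 U).le hZ.le),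
    integral_div, div_self hZ.ne', ENNReal.ofReal_one]

/-- **The heat-bath–proposal exact sampler of the periodic target: Doeblin ⇒ `τ_int ≤ (M/m)^k − 1/2`
for EVERY bounded observable.**  `w` continuous with `0 < m ≤ w ≤ M`; `B` any set of base sites
(plaquettes) of `(ℤ/L)²`, `k = #(Bᶜ)`; `F_B = ∏_{p∈B} w(U_p)`, `F_R = ∏_{p∉B} w(U_p)`,
`F = ∏_{all p} w(U_p) = F_R·F_B` the full periodic weight; `π = (F/Z)·Haar^{⊗E}` the periodic target
and `q = (F_B/Z_B)·Haar^{⊗E}` — by `Scaling/AutoregressiveGaugeHeatBathExact2D` the LAW of the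
one-plaquette heat-bath autoregressive sampler when `B` is a free-boundary block (both ARE probability
measures: `isProbabilityMeasure_haarPi_withDensity_div_integral`).  Then `q = ρ·π` with `ρ = Z/(Z_B·F_R)`,
`ρ(U) ≤ (M/m)^k ρ(V)`, and for the exact independence Metropolis kernel `K = indepMH q (1/ρ)`
(acceptance `min(1, F_R(V)/F_R(U))`, invariant law `π`): every bounded measurable `π`-centred
observable `f` has `|C_f(t)| ≤ (1 − (m/M)^k)^t ∫ f² dπ` for all `t` and `τ_int(f) ≤ (M/m)^k − 1/2`
(the scorers' `τ_int`). [ours] -/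
theorem hbProposal_autocorrelation {w : G → ℝ} (hw : Continuous w) {m M : ℝ} (hm0 : 0 < m)
    (hm : ∀ g, m ≤ w g) (hM : ∀ g, w g ≤ M) (B : Finset (Site 2 L))
    (π q : Measure (GaugeConfig 2 L G)) [IsProbabilityMeasure π] [IsProbabilityMeasure q]
    (hπ : π = (Measure.pi fun _ : Edge 2 L => haarProbability G).withDensity fun U =>
      ENNReal.ofReal ((∏ p : Site 2 L, w (plaquetteHolonomy U p 0 1)) /
        ∫ V, ∏ p : Site 2 L, w (plaquetteHolonomy V p 0 1)
          ∂(Measure.pi fun _ : Edge 2 L => haarProbability G)))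
    (hq : q = (Measure.pi fun _ : Edge 2 L => haarProbability G).withDensity fun U =>
      ENNReal.ofReal ((∏ p ∈ B, w (plaquetteHolonomy U p 0 1)) /
        ∫ V, ∏ p ∈ B, w (plaquetteHolonomy V p 0 1)
          ∂(Measure.pi fun _ : Edge 2 L => haarProbability G)))
    {f : GaugeConfig 2 L G → ℝ} (hf : Measurable f) {C : ℝ} (hC : ∀ x, |f x| ≤ C)
    (hf0 : ∫ U, f U ∂π = 0) :
    (∀ t : ℕ, |autocov (indepMH q fun U =>
        ((∫ V, ∏ p : Site 2 L, w (plaquetteHolonomy V p 0 1)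
            ∂(Measure.pi fun _ : Edge 2 L => haarProbability G)) /
          ((∫ V, ∏ p ∈ B, w (plaquetteHolonomy V p 0 1)
            ∂(Measure.pi fun _ : Edge 2 L => haarProbability G)) *
            ∏ p ∈ Finset.univ \ B, w (plaquetteHolonomy U p 0 1)))⁻¹) π f t|
        ≤ (1 - (m / M) ^ (Finset.univ \ B).card) ^ t * ∫ x, f x ^ 2 ∂π) ∧
      tauInt (fun t => autocov (indepMH q fun U =>
        ((∫ V, ∏ p : Site 2 L, w (plaquetteHolonomy V p 0 1)
            ∂(Measure.pi fun _ : Edge 2 L => haarProbability G)) /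
          ((∫ V, ∏ p ∈ B, w (plaquetteHolonomy V p 0 1)
            ∂(Measure.pi fun _ : Edge 2 L => haarProbability G)) *
            ∏ p ∈ Finset.univ \ B, w (plaquetteHolonomy U p 0 1)))⁻¹) π f t /
          autocov (indepMH q fun U =>
        ((∫ V, ∏ p : Site 2 L, w (plaquetteHolonomy V p 0 1)
            ∂(Measure.pi fun _ : Edge 2 L => haarProbability G)) /
          ((∫ V, ∏ p ∈ B, w (plaquetteHolonomy V p 0 1)
            ∂(Measure.pi fun _ : Edge 2 L => haarProbability G)) *
            ∏ p ∈ Finset.univ \ B, w (plaquetteHolonomy U p 0 1)))⁻¹) π f 0) ≤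
        (M / m) ^ (Finset.univ \ B).card - 1 / 2 := by
  set Haar : Measure (GaugeConfig 2 L G) := Measure.pi fun _ : Edge 2 L => haarProbability G with hHaar
  set FT : GaugeConfig 2 L G → ℝ := fun U => ∏ p : Site 2 L, w (plaquetteHolonomy U p 0 1) with hFT
  set FB : GaugeConfig 2 L G → ℝ := fun U => ∏ p ∈ B, w (plaquetteHolonomy U p 0 1) with hFB
  set FR : GaugeConfig 2 L G → ℝ := fun U => ∏ p ∈ Finset.univ \ B, w (plaquetteHolonomy U p 0 1)
    with hFR
  set ZT : ℝ := ∫ V, FT V ∂Haar with hZT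
  set ZB : ℝ := ∫ V, FB V ∂Haar with hZB
  set k : ℕ := (Finset.univ \ B).card with hk
  have hw0 : ∀ g, 0 < w g := fun g => hm0.trans_le (hm g)
  have hMpos : 0 < M := (hw0 1).trans_le (hM 1)
  haveI : IsProbabilityMeasure Haar := by rw [hHaar]; infer_instance
  have hFTc : Continuous FT := continuous_prodPlaquetteWeight hw Finset.univ
  have hFBc : Continuous FB := continuous_prodPlaquetteWeight hw B
  have hFRc : Continuous FR := continuous_prodPlaquetteWeight hw (Finset.univ \ B)
  have hFTpos : ∀ U, 0 < FT U := fun U => prod_pos fun p _ => hw0 _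
  have hFBpos : ∀ U, 0 < FB U := fun U => prod_pos fun p _ => hw0 _
  have hFRpos : ∀ U, 0 < FR U := fun U => prod_pos fun p _ => hw0 _
  have hFRge : ∀ U, m ^ k ≤ FR U := fun U => (pow_le_prodPlaquetteWeight_le_pow hm0 hm hM _ U).1
  have hFRle : ∀ U, FR U ≤ M ^ k := fun U => (pow_le_prodPlaquetteWeight_le_pow hm0 hm hM _ U).2
  have hsplit : ∀ U, FT U = FR U * FB U := fun U => (Finset.prod_sdiff (Finset.subset_univ B)).symm
  have hint : ∀ {F : GaugeConfig 2 L G → ℝ}, Continuous F → (∀ U, 0 < F U) → ∀ K : ℝ, (∀ U, F U ≤ K) →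
      Integrable F Haar := by
    intro F hF hF0 K hK
    refine Integrable.mono' (integrable_const K) hF.aestronglyMeasurable (ae_of_all _ fun U => ?_)
    rw [Real.norm_eq_abs, abs_of_pos (hF0 U)]; exact hK U
  have hFTi : Integrable FT Haar :=
    hint hFTc hFTpos (M ^ (Finset.univ : Finset (Site 2 L)).card)
      fun U => (pow_le_prodPlaquetteWeight_le_pow hm0 hm hM _ U).2
  have hFBi : Integrable FB Haar :=
    hint hFBc hFBpos (M ^ B.card) fun U => (pow_le_prodPlaquetteWeight_le_pow hm0 hm hM _ U).2
  have hZge : ∀ {F : GaugeConfig 2 L G → ℝ}, Integrable F Haar → ∀ c : ℝ, (∀ U, c ≤ F U) →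
      c ≤ ∫ V, F V ∂Haar := by
    intro F hFi c hc
    have h := integral_mono (integrable_const c) hFi hc
    rwa [integral_const, smul_eq_mul, probReal_univ, one_mul] at h
  have hZTpos : 0 < ZT :=
    lt_of_lt_of_le (pow_pos hm0 _) (hZge hFTi (m ^ (Finset.univ : Finset (Site 2 L)).card)
      fun U => (pow_le_prodPlaquetteWeight_le_pow hm0 hm hM _ U).1)
  have hZBpos : 0 < ZB :=
    lt_of_lt_of_le (pow_pos hm0 _) (hZge hFBi (m ^ B.card) fun U => (pow_le_prodPlaquetteWeight_le_pow hm0 hm hM _ U).1)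
  -- the density ratio `ρ = Z_T/(Z_B F_R)` : `q = ρ · π`
  set ρ : GaugeConfig 2 L G → ℝ := fun U => ZT / (ZB * FR U) with hρ
  have hρpos : ∀ U, 0 < ρ U := fun U => div_pos hZTpos (mul_pos hZBpos (hFRpos U))
  have hρm : Measurable ρ := (continuous_const.div (continuous_const.mul hFRc)
    fun U => (mul_pos hZBpos (hFRpos U)).ne').measurable
  have hρq : q = π.withDensity fun U => ENNReal.ofReal (ρ U) := by
    rw [hq, hπ]
    change Haar.withDensity (fun U => ENNReal.ofReal (FB U / ZB)) =
      (Haar.withDensity fun U => ENNReal.ofReal (FT U / ZT)).withDensity fun U => ENNReal.ofReal (ρ U)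
    rw [← withDensity_mul _ (by fun_prop : Measurable fun U => ENNReal.ofReal (FT U / ZT))
      (by exact hρm.ennreal_ofReal)]
    refine withDensity_congr_ae (ae_of_all _ fun U => ?_)
    simp only [Pi.mul_apply]
    rw [← ENNReal.ofReal_mul (div_nonneg (hFTpos U).le hZTpos.le)]
    congr 1
    rw [hρ, hsplit U]
    field_simp [(hFRpos U).ne', hZBpos.ne', hZTpos.ne']
  -- the oscillation bound `ρ U ≤ (M/m)^k ρ V`
  have hmM : 0 < M / m := div_pos hMpos hm0
  have hosc : ∀ U V, ρ U ≤ Real.exp (k * Real.log (M / m)) * ρ V := by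
    intro U V
    rw [Real.exp_nat_mul, Real.exp_log hmM]
    have hm0' : m ≠ 0 := hm0.ne'
    have hM0' : M ≠ 0 := hMpos.ne'
    calc ρ U = ZT / (ZB * FR U) := rfl
      _ ≤ ZT / (ZB * m ^ k) :=
          div_le_div_of_nonneg_left hZTpos.le (mul_pos hZBpos (pow_pos hm0 k))
            (mul_le_mul_of_nonneg_left (hFRge U) hZBpos.le)
      _ = (M / m) ^ k * (ZT / (ZB * M ^ k)) := by
          rw [div_pow]; field_simp
      _ ≤ (M / m) ^ k * (ZT / (ZB * FR V)) :=
          mul_le_mul_of_nonneg_left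
            (div_le_div_of_nonneg_left hZTpos.le (mul_pos hZBpos (hFRpos V))
              (mul_le_mul_of_nonneg_left (hFRle V) hZBpos.le)) (pow_nonneg hmM.le k)
      _ = (M / m) ^ k * ρ V := rfl
  have hmain := indepMH_autocorrelation_of_density_ratio (π := π) (q := q) hρm hρpos hρq hosc hf hC hf0
  obtain ⟨hcov, htau, -⟩ := hmain
  have hexp : Real.exp (k * Real.log (M / m)) = (M / m) ^ k := by
    rw [Real.exp_nat_mul, Real.exp_log hmM]
  have hexpneg : Real.exp (-(k * Real.log (M / m))) = (m / M) ^ k := by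
    rw [Real.exp_neg, hexp, ← inv_pow, inv_div]
  refine ⟨fun t => ?_, ?_⟩
  · have h := hcov t
    rwa [hexpneg] at h
  · rwa [hexp] at htau

/-- **The perimeter law for the integrated autocorrelation time.**  `L ≥ 2` and `B` the largest
free-boundary block, `(L−1) × (L−1)` at `(i, j)`: `k = 2L − 1`, so every bounded measurable centred
observable of the exact heat-bath–proposal sampler of the periodic target has
`|C_f(t)| ≤ (1 − (m/M)^{2L−1})^t ∫ f² dπ` and `τ_int(f) ≤ (M/m)^{2L−1} − 1/2` — for the Wilson weight
(`m/M = e^{−2β}`) `τ_int ≤ e^{2β(2L−1)} − 1/2`, growing with the PERIMETER, at every coupling. [ours] -/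
theorem hbProposal_autocorrelation_perimeter (hL : 2 ≤ L) {w : G → ℝ} (hw : Continuous w) {m M : ℝ}
    (hm0 : 0 < m) (hm : ∀ g, m ≤ w g) (hM : ∀ g, w g ≤ M) (i j : ZMod L)
    (π q : Measure (GaugeConfig 2 L G)) [IsProbabilityMeasure π] [IsProbabilityMeasure q]
    (hπ : π = (Measure.pi fun _ : Edge 2 L => haarProbability G).withDensity fun U =>
      ENNReal.ofReal ((∏ p : Site 2 L, w (plaquetteHolonomy U p 0 1)) /
        ∫ V, ∏ p : Site 2 L, w (plaquetteHolonomy V p 0 1)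
          ∂(Measure.pi fun _ : Edge 2 L => haarProbability G)))
    (hq : q = (Measure.pi fun _ : Edge 2 L => haarProbability G).withDensity fun U =>
      ENNReal.ofReal ((∏ p ∈ (range (L - 1) ×ˢ range (L - 1)).image
          (fun c : ℕ × ℕ => (![i + c.1, j + c.2] : Site 2 L)), w (plaquetteHolonomy U p 0 1)) /
        ∫ V, ∏ p ∈ (range (L - 1) ×ˢ range (L - 1)).image
          (fun c : ℕ × ℕ => (![i + c.1, j + c.2] : Site 2 L)), w (plaquetteHolonomy V p 0 1)
          ∂(Measure.pi fun _ : Edge 2 L => haarProbability G)))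
    {f : GaugeConfig 2 L G → ℝ} (hf : Measurable f) {C : ℝ} (hC : ∀ x, |f x| ≤ C)
    (hf0 : ∫ U, f U ∂π = 0) :
    (∀ t : ℕ, |autocov (indepMH q fun U =>
        ((∫ V, ∏ p : Site 2 L, w (plaquetteHolonomy V p 0 1)
            ∂(Measure.pi fun _ : Edge 2 L => haarProbability G)) /
          ((∫ V, ∏ p ∈ (range (L - 1) ×ˢ range (L - 1)).image
              (fun c : ℕ × ℕ => (![i + c.1, j + c.2] : Site 2 L)), w (plaquetteHolonomy V p 0 1)
            ∂(Measure.pi fun _ : Edge 2 L => haarProbability G)) *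
            ∏ p ∈ Finset.univ \ (range (L - 1) ×ˢ range (L - 1)).image
              (fun c : ℕ × ℕ => (![i + c.1, j + c.2] : Site 2 L)), w (plaquetteHolonomy U p 0 1)))⁻¹) π f t|
        ≤ (1 - (m / M) ^ (2 * L - 1)) ^ t * ∫ x, f x ^ 2 ∂π) ∧
      tauInt (fun t => autocov (indepMH q fun U =>
        ((∫ V, ∏ p : Site 2 L, w (plaquetteHolonomy V p 0 1)
            ∂(Measure.pi fun _ : Edge 2 L => haarProbability G)) /
          ((∫ V, ∏ p ∈ (range (L - 1) ×ˢ range (L - 1)).image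
              (fun c : ℕ × ℕ => (![i + c.1, j + c.2] : Site 2 L)), w (plaquetteHolonomy V p 0 1)
            ∂(Measure.pi fun _ : Edge 2 L => haarProbability G)) *
            ∏ p ∈ Finset.univ \ (range (L - 1) ×ˢ range (L - 1)).image
              (fun c : ℕ × ℕ => (![i + c.1, j + c.2] : Site 2 L)), w (plaquetteHolonomy U p 0 1)))⁻¹) π f t /
          autocov (indepMH q fun U =>
        ((∫ V, ∏ p : Site 2 L, w (plaquetteHolonomy V p 0 1)
            ∂(Measure.pi fun _ : Edge 2 L => haarProbability G)) /
          ((∫ V, ∏ p ∈ (range (L - 1) ×ˢ range (L - 1)).image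
              (fun c : ℕ × ℕ => (![i + c.1, j + c.2] : Site 2 L)), w (plaquetteHolonomy V p 0 1)
            ∂(Measure.pi fun _ : Edge 2 L => haarProbability G)) *
            ∏ p ∈ Finset.univ \ (range (L - 1) ×ˢ range (L - 1)).image
              (fun c : ℕ × ℕ => (![i + c.1, j + c.2] : Site 2 L)), w (plaquetteHolonomy U p 0 1)))⁻¹) π f 0) ≤
        (M / m) ^ (2 * L - 1) - 1 / 2 := by
  have h := hbProposal_autocorrelation hw hm0 hm hM
    ((range (L - 1) ×ˢ range (L - 1)).image (fun c : ℕ × ℕ => (![i + c.1, j + c.2] : Site 2 L)))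
    π q hπ hq hf hC hf0
  rw [card_univ_sdiff_maxBlock (L := L) hL i j] at h
  exact h

end Summit.Ventures.LatticeQCDFlow.Theory2.Autoregressive
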